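import Summits.CriticalPhenomena.PercolationContinuityZ3.Theorems.PercNearOneGluingNoHeavyQuantDIBStarFloorSplitInductionLumpyPC
import Summits.CriticalPhenomena.PercolationContinuityZ3.Theorems.PercNearOneGluingNoHeavyQuantDIBStarHighFloors
import HarnessLib

/-!
# QUANT lane R8, Conjecture DIB\* — the open class of T-DIB after the transport cells: the lumpy core with a non-completing pair
# AT FLOORS `1/2 < x < 7/8` (`StepLemmaFSMid ↔ ∀ x < 1, DIBStar x`)

builds on p205010 (kernel theorem, internal audit signed; external expert review pending)

Statement + support file (`--supports stmt-CriticalPhenomena-4575`), QUANT lane typer seat prim-quant-stmt (gen 21).  ONE `Prop`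
definition (the `@[conjecture]` `StepLemmaFSMid`), theorems otherwise; no sorries, standard axioms.

`…FloorSplitInductionLumpyPC` (lead g18, p266400) left as the open class of T-DIB the lumpy core with a non-completing pair at every floor
`1/2 < x < 1`.  Typer g21's `dibStar_of_ge_seven_eighths` (`…QuantDIBStarHighFloors`, p279119: Hall + antipodal-Harris transport after
splitting on the largest blob, + Cantelli) proves `DIBStar x` for every `x ∈ [7/8, 1)`.  This file removes those floors from the class:

* `Quant.IndepBlob.StepLemmaFSMid` (`@[conjecture]`) — `StepLemmaFSLumpyPC` with the extra hypothesis `x < 7/8`.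
* `stepLemmaFSLumpyPC_of_mid`, **`stepLemmaFSMid_iff_dibStar : StepLemmaFSMid ↔ ∀ x < 1, DIBStar x`**, `dibStar_iff_mid_floors`
  (`(∀ x < 1, DIBStar x) ↔ ∀ x ∈ (1/2, 7/8), DIBStar x`).

OPEN CLASS OF T-DIB after this file: floor `1/2 < x < 7/8`; sizes `≤ j`; heavy total `≤ 2j`; empty blobs sure; ≥ 3 non-empty lights
(`x² < g < x`), light total `≥ j+1`; credit `> 2j`; the largest blob has size `> j/(2x)` and gate `< 1`; some two non-empty blobs do not
reach `j + 1` together; plus the inductive capped rows of every one-blob deletion.  At these floors the transport item is numerically idle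
(seat folder work/explore/tr10.py: the binding certificate items on the class are exact-∨ ⊗ Cantelli at the lower level and Cantelli at the
upper level, adversarial margin ≥ 0.17).  [this work]; the gluing rows served [cite: KozmaNitzan2024, Conjecture 3 (p. 15)].
-/

namespace Summit.CriticalPhenomena.PercolationContinuityZ3.Theorems

namespace Quant

namespace IndepBlob

open Finset

/-- **CONJECTURE — the floor-split step lemma on the lumpy core with a non-completing pair, MID FLOORS ONLY** (`1/2 < x < 7/8`):
`StepLemmaFSLumpyPC` (lead g18) with the extra hypothesis `x < 7/8`.  Equivalent to `∀ x < 1, DIBStar x` (`stepLemmaFSMid_iff_dibStar`);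
the floors `x ≥ 7/8` are typer g21's kernel theorem `dibStar_of_ge_seven_eighths` (p279119).  builds on p205010 (kernel theorem, internal
audit signed; external expert review pending). [this work] [status: open] -/
@[conjecture] def StepLemmaFSMid : Prop :=
  ∀ (κ : Type) [Fintype κ] [DecidableEq κ] (a : κ → ℕ) (g : κ → ℝ) (j : ℕ) (x : ℝ),
    1 / 2 < x → x < 7 / 8 →
    (∀ k, 0 ≤ g k ∧ g k ≤ 1) →
    (∀ k, g k < x → a k ≤ j) →
    (∑ k ∈ Finset.univ.filter (fun k => x ≤ g k), a k ≤ 2 * j) →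
    (∀ k, x ≤ g k → a k ≤ j) →
    (∃ k₁ k₂ k₃, k₁ ≠ k₂ ∧ k₁ ≠ k₃ ∧ k₂ ≠ k₃ ∧ g k₁ < x ∧ 0 < a k₁ ∧ g k₂ < x ∧ 0 < a k₂ ∧ g k₃ < x ∧ 0 < a k₃) →
    (j + 1 ≤ ∑ k ∈ Finset.univ.filter (fun k => g k < x), a k) →
    (∀ k, g k < x → 0 < a k → x ^ 2 < g k) →
    (∀ k, (∀ i, a i ≤ a k) → g k < 1) →
    (∀ k, a k = 0 → g k = 1) →
    (∃ k, (j : ℝ) < 2 * x * a k) →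
    (∃ k l, k ≠ l ∧ 0 < a k ∧ 0 < a l ∧ a k + a l ≤ j) →
    (2 * j : ℝ) < ∑ k, (a k : ℝ) * (if x ≤ g k then g k else (g k - x ^ 2) / (1 - x)) →
    (∀ k, 0 < a k → RootDec.CappedRows (Function.update a k 0) g) →
    x ≤ ∑ W : Finset κ, (∏ k, if k ∈ W then g k else 1 - g k) * (if j + 1 ≤ ∑ k ∈ W, a k then (1 : ℝ) else 0)

/-- The mid-floor step lemma follows from DIB\* below one. [this work] -/
theorem stepLemmaFSMid_of_dibStar (h : ∀ x : ℝ, x < 1 → DIBStar x) : StepLemmaFSMid :=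
  fun κ _ _ a g j x _ hx78 hg hlight _ _ _ _ _ _ _ _ _ hcredit _ => h x (by linarith) κ a g j hg hlight hcredit

/-- It is a special case of `StepLemmaFSLumpyPC`. [this work] -/
theorem stepLemmaFSMid_of_lumpyPC (H : StepLemmaFSLumpyPC) : StepLemmaFSMid :=
  fun κ _ _ a g j x hx hx78 hg hlight hcorner hnogiant hthree hbig hpos hcore hempty hgran hpair hcredit hIH =>
    H κ a g j x hx (by linarith) hg hlight hcorner hnogiant hthree hbig hpos hcore hempty hgran hpair hcredit hIH

/-- **The floors `x ≥ 7/8` are kernel (typer g21)**: `StepLemmaFSMid → StepLemmaFSLumpyPC`. [this work] -/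
theorem stepLemmaFSLumpyPC_of_mid (H : StepLemmaFSMid) : StepLemmaFSLumpyPC := by
  intro κ _ _ a g j x hx hx1 hg hlight hcorner hnogiant hthree hbig hpos hcore hempty hgran hpair hcredit hIH
  by_cases h78 : 7 / 8 ≤ x
  · exact dibStar_of_ge_seven_eighths x h78 hx1 κ a g j hg hlight hcredit
  · exact H κ a g j x hx (not_le.1 h78) hg hlight hcorner hnogiant hthree hbig hpos hcore hempty hgran hpair hcredit hIH

/-- **`StepLemmaFSMid ⟹ DIB\*` at every floor `x < 1`.** [this work] -/
theorem dibStar_of_stepLemmaFSMid (H : StepLemmaFSMid) (x : ℝ) (hx1 : x < 1) : DIBStar x :=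
  dibStar_of_stepLemmaFSLumpyPC (stepLemmaFSLumpyPC_of_mid H) x hx1

/-- **T-DIB ≡ the mid-floor step lemma**: `StepLemmaFSMid ↔ ∀ x < 1, DIBStar x`. [this work] -/
theorem stepLemmaFSMid_iff_dibStar : StepLemmaFSMid ↔ ∀ x : ℝ, x < 1 → DIBStar x :=
  ⟨fun H x hx => dibStar_of_stepLemmaFSMid H x hx, stepLemmaFSMid_of_dibStar⟩

/-- **Conjecture DIB\* below one is decided on the open interval `(1/2, 7/8)`**: `(∀ x < 1, DIBStar x) ↔ (∀ x ∈ (1/2, 7/8), DIBStar x)`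
(`DIBStar.of_le_half` below `1/2`, `dibStar_of_ge_seven_eighths` from `7/8`). [this work] -/
theorem dibStar_iff_mid_floors : (∀ x : ℝ, x < 1 → DIBStar x) ↔ ∀ x : ℝ, x ∈ Set.Ioo (1 / 2 : ℝ) (7 / 8) → DIBStar x := by
  constructor
  · intro h x hx
    exact h x (by linarith [hx.2])
  · intro h x hx1
    by_cases hmem : x ∈ Set.Ioo (1 / 2 : ℝ) (7 / 8)
    · exact h x hmem
    · exact dibStar_of_not_mem_Ioo x hx1 hmem

end IndepBlob

end Quant

end Summit.CriticalPhenomena.PercolationContinuityZ3.Theorems
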